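import Mathlib
import Literature.AlgebraicGeometry.Resolution.WeakJacobianPolynomial
import Literature.AlgebraicGeometry.Resolution.WeakJacobianMizutaniProof
import Literature.AlgebraicGeometry.Resolution.RegularQuotientIdeal
import Literature.AlgebraicGeometry.Resolution.StrictNormalCrossingsDescent
import Literature.AlgebraicGeometry.Resolution.StrictNormalCrossingsAt
import Literature.AlgebraicGeometry.Resolution.RsopMonomialIdeals
import Literature.AlgebraicGeometry.Resolution.DualDerivationsPrimeField
import Literature.AlgebraicGeometry.Resolution.IdealsSpreadFromLocalization
import HarnessLib

/-!
# Crux stmt-ResolutionOfSingularities-15917 (`RadicialJung.CleanModels`), stub `stub_cleanSpreads`,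
# part 1: derivations of a finitely generated algebra dual to a regular system of parameters

Support file for the stub `stub_cleanSpreads` (line `Sketch`, rev 7) of the crux `CleanModels`:
the source of derivations used to spread cleanness from a closed point.

**Theorem** (`exists_derivations_dual_of_finiteType`). Let `B` be a domain of finite type over a
field `k`, `𝔮` a maximal ideal with `B_𝔮` regular of dimension `d`, and `a_1, …, a_d ∈ B` generating
`𝔮 B_𝔮`. Then there are derivations `E_1, …, E_d ∈ Der(B) = Der_ℤ(B, B)` of `B` ITSELF and
`e ∈ B ∖ 𝔮` with `E_j(a_l) = e δ_jl`.

Proof. Present `B = S/I`, `S = k[X_1, …, X_n]`, `M ⊇ I` the maximal ideal over `𝔮`; `I S_M` is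
generated by elements `g_1, …, g_c ∈ I` with independent differentials (Matsumura Thm. 14.2, tree
`exists_span_eq_of_isRegularLocalRing_quotient`), and `(g, a)` is a regular system of parameters of
`S_M` (`c + d = dim S_M = ht M`). The weak Jacobian condition (WJ) at `M` (tree
`isWeakJacobianAt_mvPolynomial`, Matsumura Thms. 30.3/30.5) gives `D_1, …, D_n ∈ Der(S)` and
`f_1, …, f_n ∈ M` with `det(D_i f_j) ∉ M`; writing `w_j f_j = Σ C_jl y_l` for `y = (g, a)` and
differentiating modulo `M` shows `det(D_i y_l) ∉ M` (`exists_derivations_dual_of_isWeakJacobianAt`);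
the adjugate combinations `E = adj(D y) · D ∈ Der(S)` satisfy `E_j(y_l) = det(D y) δ_jl`, so the
`E_j` dual to the `a`-block kill the `g_i`, hence map `I` into `I`
(`derivation_apply_mem_ker_of_forall`) and descend to `B`.
-/

noncomputable section

set_option linter.dupNamespace false -- mandated namespace of this single-conjunct summit

open IsLocalRing Literature.AlgebraicGeometry.Resolution

namespace Summit.ResolutionOfSingularities.ResolutionOfSingularities.Theorems.RadicialJung.CleanModels

universe u v w

/-! ## Derivations of a finitely generated algebra dual to a regular system of parameters -/

/-- **Dual derivations from the weak Jacobian condition.** Let `M` be a maximal ideal of `R` at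
which (WJ) holds, and `y : ι → M` a family of `ht M` elements generating `M R_M`. Then there are
derivations `E_j ∈ Der(R)` and `e ∈ R ∖ M` with `E_j(y_l) = e δ_jl`: if `D_1, …, D_r`, `f_1, …, f_r`
witness (WJ), then writing `w_j f_j = Σ C_jl y_l` (`w_j ∉ M`) and differentiating modulo `M` gives
`det(D_i f_j) ∏ w_j ≡ det(D_i y_l) det C`, so `e = det(D_i y_l) ∉ M`, and `E = adj(D y) · D`. -/
theorem exists_derivations_dual_of_isWeakJacobianAt {R : Type u} [CommRing R] (M : Ideal R)
    [hM : M.IsMaximal] (hWJ : IsWeakJacobianAt M) {ι : Type v} [Fintype ι] [DecidableEq ι]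
    (y : ι → R) (hyM : ∀ i, y i ∈ M) (hcard : (Fintype.card ι : ℕ∞) = M.height)
    (hy : M.map (algebraMap R (Localization.AtPrime M)) ≤
      Ideal.span (Set.range fun i => algebraMap R (Localization.AtPrime M) (y i))) :
    ∃ (E : ι → Derivation ℤ R R) (e : R), e ∉ M ∧
      ∀ j l, E j (y l) = if j = l then e else 0 := by
  classical
  obtain ⟨r, hr, D, f, hf, hdet⟩ := hWJ
  have hrc : Fintype.card ι = r := by
    have h := hcard.trans hr
    exact_mod_cast h
  let σ : Fin r ≃ ι := (Fintype.equivFinOfCardEq hrc).symm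
  -- `w_j f_j = Σ_l C_jl y_l` with `w_j ∉ M`
  have hspan : Ideal.span (Set.range fun i => algebraMap R (Localization.AtPrime M) (y i)) =
      (Ideal.span (Set.range y)).map (algebraMap R (Localization.AtPrime M)) := by
    rw [Ideal.map_span, ← Set.range_comp]
    rfl
  have key : ∀ j, ∃ w : R, w ∉ M ∧ ∃ C : ι → R, ∑ l, C l * y l = w * f j := by
    intro j
    have h1 : algebraMap R (Localization.AtPrime M) (f j) ∈
        (Ideal.span (Set.range y)).map (algebraMap R (Localization.AtPrime M)) :=
      hspan ▸ hy (Ideal.mem_map_of_mem _ (hf j))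
    obtain ⟨w, hw, hwf⟩ := exists_notMem_mul_mem_of_map_mem M h1
    exact ⟨w, hw, Ideal.mem_span_range_iff_exists_fun.mp hwf⟩
  choose w hw C hC using key
  -- reduction modulo `M`
  let π := Ideal.Quotient.mk M
  letI : Field (R ⧸ M) := Ideal.Quotient.field M
  have hπy : ∀ l, π (y l) = 0 := fun l => Ideal.Quotient.eq_zero_iff_mem.mpr (hyM l)
  have hπf : ∀ j, π (f j) = 0 := fun j => Ideal.Quotient.eq_zero_iff_mem.mpr (hf j)
  have hid : ∀ i j, π (w j) * π (D i (f j)) = ∑ l, π (C j l) * π (D i (y l)) := by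
    intro i j
    have h := congrArg (fun z => π (D i z)) (hC j)
    simp only [map_sum, Derivation.leibniz, smul_eq_mul, map_add, map_mul, hπy, hπf,
      zero_mul, add_zero] at h
    rw [← h]
  -- the matrices over `R ⧸ M`
  let F : Matrix (Fin r) (Fin r) (R ⧸ M) := Matrix.of fun i j => π (D i (f j))
  let YR : Matrix (Fin r) (Fin r) R := Matrix.of fun i l => D i (y (σ l))
  let Cκ : Matrix (Fin r) (Fin r) (R ⧸ M) := Matrix.of fun j l => π (C j (σ l))
  let W : Matrix (Fin r) (Fin r) (R ⧸ M) := Matrix.diagonal fun j => π (w j)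
  have hFW : F * W = YR.map π * Cκ.transpose := by
    ext i j
    rw [Matrix.mul_diagonal, Matrix.mul_apply]
    change π (D i (f j)) * π (w j) = ∑ l, π (D i (y (σ l))) * π (C j (σ l))
    rw [mul_comm, hid i j, ← Equiv.sum_comp σ]
    exact Finset.sum_congr rfl fun l _ => mul_comm _ _
  have hdetF : F.det ≠ 0 := by
    have : F = (Matrix.of fun i j => D i (f j)).map π := by
      ext i j; rfl
    rw [this, ← RingHom.mapMatrix_apply, ← RingHom.map_det]
    exact fun h => hdet (Ideal.Quotient.eq_zero_iff_mem.mp h)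
  have hdetW : W.det ≠ 0 := by
    rw [Matrix.det_diagonal]
    exact Finset.prod_ne_zero_iff.mpr fun j _ h => hw j (Ideal.Quotient.eq_zero_iff_mem.mp h)
  have hdetY : π YR.det ≠ 0 := by
    intro h0
    have h1 : (YR.map π).det = 0 := by
      rw [← RingHom.mapMatrix_apply, ← RingHom.map_det]; exact h0
    have h2 := congrArg Matrix.det hFW
    rw [Matrix.det_mul, Matrix.det_mul, h1, zero_mul] at h2
    exact mul_ne_zero hdetF hdetW h2
  have heM : YR.det ∉ M := fun h => hdetY (Ideal.Quotient.eq_zero_iff_mem.mpr h)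
  -- the adjugate combinations
  let E' : Fin r → Derivation ℤ R R := fun l' => ∑ i, YR.adjugate l' i • D i
  have hE' : ∀ l' l, E' l' (y (σ l)) = if l' = l then YR.det else 0 := by
    intro l' l
    have h := congrFun (congrFun (Matrix.adjugate_mul YR) l') l
    rw [Matrix.mul_apply, Matrix.smul_apply, Matrix.one_apply, smul_eq_mul, mul_ite, mul_one,
      mul_zero] at h
    rw [← h, derivation_sum_apply]
    exact Finset.sum_congr rfl fun i _ => by simp [YR, Derivation.smul_apply, smul_eq_mul]
  refine ⟨fun j => E' (σ.symm j), YR.det, heM, fun j l => ?_⟩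
  have h := hE' (σ.symm j) (σ.symm l)
  rw [Equiv.apply_symm_apply] at h
  rw [h]
  by_cases hjl : j = l
  · subst hjl; simp
  · rw [if_neg hjl, if_neg (fun h' => hjl (σ.symm.injective h'))]

/-- **Descent of a derivation along a surjection.** Let `φ : S → B` be a surjection onto a domain
with kernel `I ⊆ M`, `M` prime, and suppose `I S_M = (g_1, …, g_c) S_M` with `g_i ∈ I`. A
derivation `D ∈ Der(S)` with all `D(g_i) ∈ I` maps `I` into `I` (for `x ∈ I`, `w x = Σ b_i g_i`
with `w ∉ M`, so `w D(x) ∈ I` and `D(x) ∈ I`, `I` being prime), hence descends to `B`. -/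
theorem derivation_apply_mem_ker_of_forall {S B : Type*} [CommRing S] [CommRing B] [IsDomain B]
    (φ : S →+* B) (M : Ideal S) [M.IsPrime] (hIM : RingHom.ker φ ≤ M) {c : ℕ} (g : Fin c → S)
    (hg : ∀ i, g i ∈ RingHom.ker φ)
    (hgen : (RingHom.ker φ).map (algebraMap S (Localization.AtPrime M)) ≤
      (Ideal.span (Set.range g)).map (algebraMap S (Localization.AtPrime M)))
    (D : Derivation ℤ S S) (hD : ∀ i, D (g i) ∈ RingHom.ker φ) (x : S) (hx : φ x = 0) :
    φ (D x) = 0 := by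
  have hxI : x ∈ RingHom.ker φ := hx
  haveI : (RingHom.ker φ).IsPrime := RingHom.ker_isPrime φ
  obtain ⟨w, hw, hwx⟩ := exists_notMem_mul_mem_of_map_mem M (hgen (Ideal.mem_map_of_mem _ hxI))
  obtain ⟨b, hb⟩ := Ideal.mem_span_range_iff_exists_fun.mp hwx
  have h1 : D (w * x) ∈ RingHom.ker φ := by
    rw [← hb, map_sum]
    refine Ideal.sum_mem _ fun i _ => ?_
    rw [Derivation.leibniz, smul_eq_mul, smul_eq_mul]
    exact Ideal.add_mem _ (Ideal.mul_mem_left _ _ (hD i)) (Ideal.mul_mem_right _ _ (hg i))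
  rw [Derivation.leibniz, smul_eq_mul, smul_eq_mul] at h1
  have h2 : w * D x ∈ RingHom.ker φ :=
    (Ideal.add_mem_iff_left _ (Ideal.mul_mem_right _ _ hxI)).mp h1
  have hwI : w ∉ RingHom.ker φ := fun h => hw (hIM h)
  exact (‹(RingHom.ker φ).IsPrime›.mem_or_mem h2).resolve_left hwI

/-- **Derivations of a finitely generated algebra dual to a regular system of parameters.** Let
`B` be a domain of finite type over a field `k`, `𝔮` a maximal ideal with `B_𝔮` regular of
dimension `d`, and `a_1, …, a_d ∈ B` generating `𝔮 B_𝔮`. Then there are derivations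
`E_1, …, E_d ∈ Der(B)` and `e ∈ B ∖ 𝔮` with `E_j(a_l) = e δ_jl`. (Present `B = S/I`,
`S = k[X_1, …, X_n]`, `M = 𝔮 ∩ S`; `I S_M = (g_1, …, g_c) S_M` with `g_i ∈ I` having independent
differentials, Matsumura Thm. 14.2, so `(g, a)` is a regular system of parameters of `S_M`
(`c + d = dim S_M = ht M`); apply `exists_derivations_dual_of_isWeakJacobianAt` with (WJ) for
polynomial rings (Matsumura Thms. 30.3, 30.5) and descend the derivations dual to the `a`-block,
which kill the `g_i`.) -/
theorem exists_derivations_dual_of_finiteType (k : Type u) [Field k] {B : Type u} [CommRing B]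
    [IsDomain B] [Algebra k B] [Algebra.FiniteType k B] (𝔮 : Ideal B) [h𝔮 : 𝔮.IsMaximal]
    (O : Type v) [CommRing O] [Algebra B O] [IsLocalization.AtPrime O 𝔮] [IsRegularLocalRing O]
    {d : ℕ} (a : Fin d → B)
    (ha : Ideal.span (Set.range fun i => algebraMap B O (a i)) = maximalIdeal O)
    (hd : ringKrullDim O = d) :
    ∃ (E : Fin d → Derivation ℤ B B) (e : B), e ∉ 𝔮 ∧
      ∀ j l, E j (a l) = if j = l then e else 0 := by
  classical
  -- presentation `B = S/I`, `S = k[X_1, …, X_n]`, `M = φ⁻¹ 𝔮`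
  obtain ⟨n, φ, hφ⟩ :=
    Algebra.FiniteType.iff_quotient_mvPolynomial''.mp ‹Algebra.FiniteType k B›
  let I : Ideal (MvPolynomial (Fin n) k) := RingHom.ker φ.toRingHom
  let M : Ideal (MvPolynomial (Fin n) k) := 𝔮.comap φ.toRingHom
  haveI hM : M.IsMaximal := Ideal.comap_isMaximal_of_surjective _ hφ
  have hIM : I ≤ M := fun x hx => by
    change φ.toRingHom x ∈ 𝔮
    rw [RingHom.mem_ker.mp hx]
    exact zero_mem _
  let R := Localization.AtPrime M
  haveI hRreg : IsRegularLocalRing R := inferInstance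
  -- `O ≅ B_𝔮 ≅ S_M / I S_M`
  let L := Localization.AtPrime 𝔮
  let eO : O ≃ₐ[B] L := IsLocalization.algEquiv 𝔮.primeCompl O L
  let ψ : R →+* L := Localization.localRingHom M 𝔮 φ.toRingHom rfl
  have hψsurj : Function.Surjective ψ :=
    RingHom.surjectiveOnStalks_of_surjective hφ 𝔮 inferInstance
  have hψalg : ∀ s, ψ (algebraMap _ R s) = algebraMap B L (φ s) := fun s =>
    Localization.localRingHom_to_map M 𝔮 φ.toRingHom rfl s
  let J : Ideal R := I.map (algebraMap _ R)
  have hkerψ : RingHom.ker ψ = J := ker_localRingHom_of_surjective φ.toRingHom hφ 𝔮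
  let eJ : (R ⧸ J) ≃+* L := quotientMapKerEquivLocalization φ.toRingHom hφ 𝔮
  haveI hLreg : IsRegularLocalRing L := IsRegularLocalRing.of_ringEquiv eO.toRingEquiv
  haveI hRJreg : IsRegularLocalRing (R ⧸ J) := IsRegularLocalRing.of_ringEquiv eJ.symm
  have hJtop : J ≠ ⊤ := fun h =>
    not_subsingleton (R ⧸ J) (Ideal.Quotient.subsingleton_iff.mpr h)
  have hJle : J ≤ maximalIdeal R := IsLocalRing.le_maximalIdeal hJtop
  -- the regular system of parameters `a` read in `L`
  have haL : Ideal.span (Set.range fun i => algebraMap B L (a i)) = maximalIdeal L := by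
    have h := congrArg (Ideal.map (eO.toRingEquiv : O →+* L)) ha
    rw [Ideal.map_span, ← Set.range_comp] at h
    have h2 : (maximalIdeal O).map (eO.toRingEquiv : O →+* L) = maximalIdeal L :=
      IsLocalRing.map_ringEquiv_maximalIdeal eO.toRingEquiv
    rw [h2] at h
    rw [← h]
    congr 1
    ext z
    simp only [Set.mem_range, Function.comp_apply]
    constructor
    · rintro ⟨i, rfl⟩
      exact ⟨i, eO.commutes (a i)⟩
    · rintro ⟨i, rfl⟩
      exact ⟨i, (eO.commutes (a i)).symm⟩
  have hdimL : ringKrullDim L = d := by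
    rw [← ringKrullDim_eq_of_ringEquiv eO.toRingEquiv, hd]
  -- generators `g_i ∈ I` of `J` with independent differentials
  obtain ⟨c, g, hgG, hgspan, hli⟩ := exists_span_eq_of_isRegularLocalRing_quotient hJle
    ((algebraMap _ R) '' (I : Set (MvPolynomial (Fin n) k))) rfl
  choose g' hg'I hg' using fun i => hgG i
  have hgm : ∀ i, g i ∈ maximalIdeal R := fun i => hJle (hgspan ▸ Ideal.subset_span ⟨i, rfl⟩)
  -- dimension count `c + d = dim S_M = ht M`
  have hind := (linearIndependent_toCotangent_iff_forall_mem g hgm).mp hli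
  obtain ⟨e₀, y₀, hdimR, hspanR⟩ := exists_extend_to_rsop g hgm hind
  have hrsop : IsRsopPart g := ⟨hRreg, e₀, y₀, hdimR, hspanR⟩
  have hdimRJ : ringKrullDim (R ⧸ J) = d := by
    rw [ringKrullDim_eq_of_ringEquiv eJ, hdimL]
  have hcd : ringKrullDim R = ((c + d : ℕ) : WithBot ℕ∞) := by
    have h := hrsop.ringKrullDim_quotient_add
    rw [hgspan, hdimRJ] at h
    rw [← h]
    push_cast
    ring
  have hheight : ((Fintype.card (Fin c ⊕ Fin d) : ℕ) : ℕ∞) = M.height := by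
    have h := IsLocalization.AtPrime.ringKrullDim_eq_height M R
    rw [hcd] at h
    rw [Fintype.card_sum, Fintype.card_fin, Fintype.card_fin]
    exact_mod_cast h
  -- the regular system of parameters `y = (g, a)` of `S_M`, with entries in `S`
  choose a' ha' using fun l => hφ (a l)
  let yv : Fin c ⊕ Fin d → MvPolynomial (Fin n) k := Sum.elim g' a'
  have ha𝔮 : ∀ l, a l ∈ 𝔮 := fun l =>
    (IsLocalization.AtPrime.to_map_mem_maximal_iff O 𝔮 (a l)).mp
      (ha ▸ Ideal.subset_span ⟨l, rfl⟩)
  have hyM : ∀ i, yv i ∈ M := by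
    rintro (i | l)
    · exact hIM (hg'I i)
    · change φ.toRingHom (a' l) ∈ 𝔮
      change φ (a' l) ∈ 𝔮
      rw [ha']
      exact ha𝔮 l
  have hy : M.map (algebraMap _ R) ≤
      Ideal.span (Set.range fun i => algebraMap _ R (yv i)) := by
    rw [Localization.AtPrime.map_eq_maximalIdeal]
    intro z hz
    -- `ψ z ∈ 𝔪_L = (a) L = ψ ((a') R)`
    have h1 : ψ z ∈ maximalIdeal L := by
      rw [← IsLocalRing.map_maximalIdeal_of_surjective ψ hψsurj]
      exact Ideal.mem_map_of_mem _ hz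
    have h2 : maximalIdeal L =
        (Ideal.span (Set.range fun l => algebraMap _ R (a' l))).map ψ := by
      rw [← haL, Ideal.map_span, ← Set.range_comp]
      congr 1
      ext w
      simp only [Set.mem_range, Function.comp_apply, hψalg, ha']
    rw [h2, Ideal.mem_map_iff_of_surjective ψ hψsurj] at h1
    obtain ⟨x, hx, hxz⟩ := h1
    have h3 : z - x ∈ J := by
      rw [← hkerψ, RingHom.mem_ker, map_sub, hxz, sub_self]
    have h4 : J ≤ Ideal.span (Set.range fun i => algebraMap _ R (yv i)) := by
      rw [← hgspan, Ideal.span_le]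
      rintro _ ⟨i, rfl⟩
      exact Ideal.subset_span ⟨Sum.inl i, (hg' i)⟩
    have h5 : Ideal.span (Set.range fun l => algebraMap _ R (a' l)) ≤
        Ideal.span (Set.range fun i => algebraMap _ R (yv i)) := by
      apply Ideal.span_mono
      rintro _ ⟨l, rfl⟩
      exact ⟨Sum.inr l, rfl⟩
    have : z = (z - x) + x := by ring
    rw [this]
    exact Ideal.add_mem _ (h4 h3) (h5 hx)
  -- dual derivations of `S` from (WJ)
  obtain ⟨E, e, heM, hE⟩ := exists_derivations_dual_of_isWeakJacobianAt M
    (isWeakJacobianAt_mvPolynomial k n M) yv hyM hheight hy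
  -- the `E (inr j)` kill the `g_i`, hence descend to `B`
  have hgen : (RingHom.ker φ.toRingHom).map (algebraMap _ R) ≤
      (Ideal.span (Set.range g')).map (algebraMap _ R) := by
    change J ≤ _
    rw [← hgspan, Ideal.map_span, Ideal.span_le]
    rintro _ ⟨i, rfl⟩
    exact Ideal.subset_span ⟨g' i, ⟨i, rfl⟩, hg' i⟩
  have hdesc : ∀ j x, φ.toRingHom x = 0 → φ.toRingHom (E (Sum.inr j) x) = 0 := fun j =>
    derivation_apply_mem_ker_of_forall φ.toRingHom M hIM g' hg'I hgen (E (Sum.inr j))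
      fun i => by
        have h := hE (Sum.inr j) (Sum.inl i)
        rw [if_neg Sum.inr_ne_inl] at h
        change E (Sum.inr j) (yv (Sum.inl i)) ∈ RingHom.ker φ.toRingHom
        rw [h]
        exact zero_mem _
  let φℤ : MvPolynomial (Fin n) k →ₐ[ℤ] B := φ.toRingHom.toIntAlgHom
  have hφℤ : Function.Surjective φℤ := hφ
  refine ⟨fun j => Derivation.liftOfSurjective (f := φℤ) hφℤ (d := E (Sum.inr j)) (hdesc j),
    φ e, fun h => heM h, fun j l => ?_⟩
  have h1 : a l = φℤ (a' l) := (ha' l).symm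
  rw [h1, Derivation.liftOfSurjective_apply]
  change φ (E (Sum.inr j) (yv (Sum.inr l))) = _
  rw [hE]
  by_cases hjl : j = l
  · subst hjl; simp
  · rw [if_neg (fun h => hjl (Sum.inr_injective h)), if_neg hjl, map_zero]

end Summit.ResolutionOfSingularities.ResolutionOfSingularities.Theorems.RadicialJung.CleanModels

end
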